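import Summits.HodgeConjecture.CorCM.MumfordTateRankTypeTwoLefschetz
import Summits.HodgeConjecture.CorCM.MumfordTateRankSevenSimpleHodge
import Literature.AlgebraicGeometry.Motives.HodgeLieWeightOnePlusLineSymmetricPair
import HarnessLib

/-!
# Quaternion fourfolds over `ℚ`: DEFINITENESS IS FORCED at Mumford–Tate rank `7` — a simple abelian fourfold with quaternion
# multiplication over `ℚ` has `dim MT(H¹B) = 7` iff `End⁰B` is totally definite (type III); in the indefinite case (type II)
# `dim MT(H¹B) ∈ {9, 10, 11}`

COR-CM (cell `pub-hodgecm2`, seat `b27` gen 45, count-neutral Mumford–Tate-rank ladder; theorems only, no definition, no named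
fact; UNCONDITIONAL — nothing here uses or asserts HC_CM).  Sequel of `CorCM/MumfordTateRankTypeTwoLefschetz` (gen 44: a simple
fourfold with totally INDEFINITE quaternion multiplication over `ℚ` has `dim MT(H¹B) ∈ {7, 9, 10, 11}`) and of
`CorCM/MumfordTateRankSevenTypeThreeConverse` (totally DEFINITE: `dim MT(H¹B) = 7`).  The value `7` is now EXCLUDED in the
indefinite case, by the Literature theorem `HodgeLieWeightOnePlusLineSymmetricPair`:

* `isSimple_hodgeLie_of_isSimple_of_two_lt_dim_of_mtRank_eq_seven` — a SIMPLE abelian variety of dimension `> 2` with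
  `𝔷 = 0` and `dim MT(H¹B) = 7` has `ℚ`-SIMPLE `Lie Hg(H¹B)` (the split alternative `B ∼ B₁^{a+1} × B₂^{b+1}` of
  `CorCM/MumfordTateRankSevenSemisimple` has simple factors of dimension `≤ 2`).
* **`mtRank_hodge_one_ne_seven_of_isSimple_fourfold_of_isTotallyIndefinite`** — `B` simple, `dim B = 4`, `End⁰B` a totally
  indefinite quaternion algebra over `ℚ` ⟹ `dim MT(H¹B) ≠ 7`.  PROOF: at `t = 7` (`𝔷 = 0`, `ℚ`-simple) the trichotomy of
  `CorCM/MumfordTateRankSevenSimpleHodge` leaves the type-III grading `(1, 1, 4)` (the RM-surface and `dim_ℚ End⁰ = 8` positions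
  have the wrong `dim_ℚ End⁰B`); there the Rosati pair `i† = -i`, `j† = +j` of `End⁰B` (Lange Thm. 2.6.5 (b),
  `exists_quaternion_pair_of_isTotallyIndefinite`) embeds the compact factor `𝔨` (dimension `3`) into `𝔰𝔬(2)` (dimension `1`):
  `2 · 6 ≤ 2 · 1 + 6` is false.
* **`mtRank_hodge_one_mem_of_isSimple_fourfold_of_isTotallyIndefinite'`** — hence `dim MT(H¹B) ∈ {9, 10, 11}` (in print `= 11`,
  Moonen–Zarhin Thm. (0.1) (4), «`Hg = Sp_D(V, φ)`»; `9, 10` are not yet excluded in the tree).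
* **`isTotallyDefinite_iff_mtRank_hodge_one_eq_seven`** — for a simple abelian FOURFOLD whose endomorphism algebra is a quaternion
  algebra over `ℚ`: `End⁰B` is totally definite ⟺ `dim MT(H¹B) = 7` (over `ℚ` a quaternion algebra is definite or indefinite).

## References
* [MoonenZarhin1999LowDim] B. Moonen, Yu. Zarhin, Math. Ann. 315 (1999), Thm. (0.1) (2), (4), §1, §2 (2.3).
* [Lange2023AbelianVarietiesComplex] H. Lange, *Abelian Varieties over the Complex Numbers* (2023), §2.6.2 Thm. 2.6.5 (b), (c).
* [Milne1999LefschetzClasses] J. S. Milne, Duke Math. J. 96 (1999), §2 (types II, III) and Summary.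
-/

noncomputable section

open scoped TensorProduct Quaternion
open CategoryTheory CategoryTheory.Limits Module

namespace Summit.HodgeConjecture.CorCM

open Literature.AlgebraicGeometry.Motives
open Literature.AlgebraicGeometry.Motives.AbelianVariety
open Literature.AlgebraicGeometry.Motives.HodgeStructure
open Literature.AlgebraicGeometry.HodgeTheory
open Literature.AlgebraicGeometry.ComplexMultiplication (bettiRep bettiRep_injective isIsogenous_biproduct_powSucc)
open Literature.AlgebraicGeometry.Milne1999 (IsOfCMType)
open Literature.NumberTheory.Automorphic (IsQuaternionAlgebra IsTotallyDefinite)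
open Literature.RingTheory.CentralSimple
open Summit.HodgeConjecture.CorCM.Domination

variable [HodgeTensorFacts.{0, 0}] {X : AbelianVariety ℂ} {n : ℕ}

/-! ## §1 A simple abelian variety of dimension `> 2` at rank `7` with `𝔷 = 0` has `ℚ`-simple Hodge Lie algebra -/

/-- **`Lie Hg(H¹B)` is `ℚ`-SIMPLE for a SIMPLE abelian variety `B` of dimension `> 2` with `𝔷 = Lie Hg ∩ End_Hdg = 0` and
`dim MT(H¹B) = 7`**: the split alternative `B ∼ B₁^{a+1} × B₂^{b+1}` of the rung (`CorCM/MumfordTateRankSevenSemisimple`) has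
simple factors of dimension `≤ 2`, and the simple `B` would be isogenous to one of them. [cite: MoonenZarhin1999LowDim, §2 (2.1)–(2.5) and §3 (3.1)]
[cite: MumfordAV1970, §19 Cor. 1–2 (pp. 173–174)] -/
theorem isSimple_hodgeLie_of_isSimple_of_two_lt_dim_of_mtRank_eq_seven (hX : IsSmoothProjective n X.X) (hXs : X.IsSimple)
    (h2 : 2 < X.dim)
    (hz : haveI := BettiUniverse.finite hX 1
      (BettiUniverse.hodge exists_isReal_hodgeModel_holds hX 1).hodgeLie ⊓
        Subalgebra.toSubmodule (BettiUniverse.hodge exists_isReal_hodgeModel_holds hX 1).endAlg = ⊥)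
    (h7 : haveI := BettiUniverse.finite hX 1
      (BettiUniverse.hodge exists_isReal_hodgeModel_holds hX 1).mtRank = 7) :
    haveI := BettiUniverse.finite hX 1
    letI : LieRing (Module.End ℚ (bettiCohomology X.X 1)) := LieRing.ofAssociativeRing
    ∀ 𝔏 : LieSubalgebra ℚ (Module.End ℚ (bettiCohomology X.X 1)),
      𝔏.toSubmodule = (BettiUniverse.hodge exists_isReal_hodgeModel_holds hX 1).hodgeLie → LieAlgebra.IsSimple ℚ 𝔏 := by
  classical
  haveI := BettiUniverse.finite hX 1
  have h0 : 0 < X.dim := by omega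
  rcases isSimple_or_exists_isIsogenous_powSucc_prod_powSucc_of_center_eq_bot_of_mtRank_eq_seven hX h0 hz h7 with h | h
  · exact h
  · exfalso
    obtain ⟨B₁, B₂, a, b, hB₁s, hB₂s, hB₁0, hB₁2, hB₂0, hB₂2, -, -, -, -, -, -, -, -, -, ⟨g, hg⟩, -, -⟩ := h
    have hdomP : AVDominatedBy ((B₁.powSucc a).prod (B₂.powSucc b))
        (⨁ AndreRiemann.sumFam (fun _ : Fin (a + 1) => B₁) (fun _ : Fin (b + 1) => B₂)) :=
      AndreRiemann.avDominatedBy_prod_of_biproduct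
        (AVDominatedBy.of_isIsogenous (isIsogenous_biproduct_powSucc B₁ a).symm' (AVDominatedBy.refl _))
        (AVDominatedBy.of_isIsogenous (isIsogenous_biproduct_powSucc B₂ b).symm' (AVDominatedBy.refl _))
    have hsimple' : ∀ j, (AndreRiemann.sumFam (fun _ : Fin (a + 1) => B₁) (fun _ : Fin (b + 1) => B₂) j).IsSimple := by
      rintro (j | j)
      · exact hB₁s
      · exact hB₂s
    obtain ⟨j, hj⟩ := exists_isIsogenous_of_isSimple_of_avDominatedBy_biproduct hsimple' hXs h0
      (((AVDominatedBy.refl X).trans_isIsogeny_hom hg).trans hdomP)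
    rcases j with j | j
    · have hj' : IsIsogenous X B₁ := hj
      obtain ⟨u, hu⟩ := hj'
      have hd := dim_eq_of_isIsogeny hu
      omega
    · have hj' : IsIsogenous X B₂ := hj
      obtain ⟨u, hu⟩ := hj'
      have hd := dim_eq_of_isIsogeny hu
      omega

/-! ## §2 Type II fourfolds over `ℚ` are not at rank `7` -/

/-- **A simple abelian FOURFOLD `B` whose endomorphism algebra is a totally INDEFINITE quaternion algebra over `ℚ` (type II) has
`dim MT(H¹B) ≠ 7`.**  At `t = 7`: `𝔷 = 0` (no type IV), `Lie Hg` is `ℚ`-simple (§1), and the trichotomy of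
`CorCM/MumfordTateRankSevenSimpleHodge` leaves the type-III grading `(1, 1, 4)` (positions (b), (c) have `dim_ℚ End⁰ = 8 ≠ 4`);
there the Rosati pair `i† = -i`, `j† = +j` (Lange Thm. 2.6.5 (b)) bounds the compact factor:
`2 · dim Lie Hg ≤ r(r-1) + 6` with `4r = dim_ℚ H¹B = 8` (`HodgeLieWeightOnePlusLineSymmetricPair`), i.e. `12 ≤ 8`.  So at
Mumford–Tate rank `7` a quaternion algebra `End⁰B` over `ℚ` is DEFINITE (Moonen–Zarhin Thm. (0.1): type II(2) has
`Hg = Sp_D(V, φ)`, type III(1) has the smaller group). [cite: MoonenZarhin1999LowDim, Thm. (0.1) (2), (4) and §2 (2.3)]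
[cite: Lange2023AbelianVarietiesComplex, §2.6.2 Thm. 2.6.5 (b)] -/
theorem mtRank_hodge_one_ne_seven_of_isSimple_fourfold_of_isTotallyIndefinite {B : AbelianVariety ℂ} {k : ℕ}
    (hB : IsSmoothProjective k B.X) (hBs : B.IsSimple) (hB4 : B.dim = 4) [IsQuaternionAlgebra ℚ B.endAlgebra]
    (hind : IsTotallyIndefinite ℚ B.endAlgebra) :
    haveI := BettiUniverse.finite hB 1
    (BettiUniverse.hodge exists_isReal_hodgeModel_holds hB 1).mtRank ≠ 7 := by
  classical
  have hk : B.dim = k := schemeDim_eq_holds hB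
  subst hk
  haveI := BettiUniverse.finite hB 1
  intro h7
  set H := BettiUniverse.hodge exists_isReal_hodgeModel_holds hB 1 with hH
  have hB0 : 0 < B.dim := by omega
  have hE4 : Module.finrank ℚ B.endAlgebra = 4 := IsQuaternionAlgebra.finrank_eq_four (K := ℚ) (D := B.endAlgebra)
  obtain ⟨-, -, hz, -⟩ := mtRank_hodge_one_mem_of_isSimple_fourfold_of_isTotallyIndefinite hB hBs hB4 hind
  have hsimple := isSimple_hodgeLie_of_isSimple_of_two_lt_dim_of_mtRank_eq_seven hB hBs (by omega) hz h7
  obtain ⟨-, h6⟩ := finrank_hodgeLie_eq_six_of_center_eq_bot_of_mtRank_eq_seven hB hB0 hz h7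
  rcases trichotomy_of_isSimple_of_center_eq_bot_of_mtRank_eq_seven hB hB0 hz h7 hsimple with
    ⟨S, hS, hD, deg, e, hF, hFc, ⟨hp1, hm1, -⟩, -⟩ | h | h
  · -- the type-III position: the symmetric partner `j` bounds the compact factor
    have heff := BettiUniverse.hodge_isEffective exists_isReal_hodgeModel_holds hB 1
    have hdeg : ∀ σ, deg σ = 0 ∨ deg σ = 1 := fun σ => by
      have h := heff.deg_mem_Icc_of_graded e hF hFc σ
      simp only [Nat.cast_one] at h
      omega
    obtain ⟨ψ⟩ := BettiUniverse.hodge_isPolarizable exists_isReal_hodgeModel_holds hB 1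
    -- a rational `X₀ ∈ Lie Hg ∖ End_Hdg`
    obtain ⟨X₀, hX₀, hX₀0⟩ : ∃ X₀ ∈ H.hodgeLie, X₀ ≠ 0 := by
      by_contra h
      push Not at h
      have hbot : H.hodgeLie = ⊥ := (Submodule.eq_bot_iff _).2 h
      rw [hbot, finrank_bot] at h6
      exact absurd h6 (by norm_num)
    have hX₀E : X₀ ∉ H.endAlg := fun hmem => hX₀0 (by
      have h : X₀ ∈ H.hodgeLie ⊓ Subalgebra.toSubmodule H.endAlg := Submodule.mem_inf.2 ⟨hX₀, hmem⟩
      rw [hz] at h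
      exact (Submodule.mem_bot ℚ).1 h)
    obtain ⟨hplus, hminus⟩ := plusLine_of_finrank_gradingPlus_eq_one H (by simp) e hF hFc hdeg hX₀ hX₀E
    -- the Rosati pair `i† = -i`, `j† = +j`
    obtain ⟨a, b, i, j, ha, hb, hi, hj, hij, hiA, hjA, -, hτj⟩ := exists_quaternion_pair_of_isTotallyIndefinite hB hBs hind ψ
    obtain ⟨r, hr, hle⟩ := exists_finrank_eq_four_mul_and_le_of_plusLine_of_symm_pair H ψ (by simp) e hF hFc hdeg hX₀ hX₀E
      (hplus hp1) (hminus hm1) hz ha hb hi hj hij hiA hjA hτj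
    have hdimV : Module.finrank ℚ (bettiCohomology B.X 1) = 8 := by rw [finrank_bettiCohomology_one_eq_two_mul_dim B, hB4]
    have hr2 : r = 2 := by omega
    subst hr2
    rw [h6] at hle
    norm_num at hle
  · obtain ⟨B', m, -, -, hB'2, -, -, ⟨g, hg⟩, hdim, hfin, -, -⟩ := h
    have hm : m = 1 := by
      have : (m + 1) * 2 = 4 := by omega
      omega
    subst hm
    rw [hE4] at hfin
    norm_num at hfin
  · obtain ⟨B', m, φ, q, -, hB'4, -, -, -, -, -, -, -, -, hdim, hfin⟩ := h
    have hm : m = 0 := by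
      have : (m + 1) * 4 = 4 := by omega
      omega
    subst hm
    rw [hE4] at hfin
    norm_num at hfin

/-- **A simple abelian FOURFOLD with totally indefinite quaternion multiplication over `ℚ` (type II, `m = 2`) has
`dim MT(H¹B) ∈ {9, 10, 11}`** — the value `7` of `CorCM/MumfordTateRankTypeTwoLefschetz` is excluded by
`mtRank_hodge_one_ne_seven_of_isSimple_fourfold_of_isTotallyIndefinite`.  (In print `t = 11`, Moonen–Zarhin Thm. (0.1) (4):
«`Hg = Sp_D(V, φ)`»; `9, 10` are not yet excluded in the tree.) [cite: MoonenZarhin1999LowDim, Thm. (0.1) (4) and §1]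
[cite: Milne1999LefschetzClasses, §2 (type II) and Summary] -/
theorem mtRank_hodge_one_mem_of_isSimple_fourfold_of_isTotallyIndefinite' {B : AbelianVariety ℂ} {k : ℕ}
    (hB : IsSmoothProjective k B.X) (hBs : B.IsSimple) (hB4 : B.dim = 4) [IsQuaternionAlgebra ℚ B.endAlgebra]
    (hind : IsTotallyIndefinite ℚ B.endAlgebra) :
    haveI := BettiUniverse.finite hB 1
    (BettiUniverse.hodge exists_isReal_hodgeModel_holds hB 1).mtRank = 9 ∨
      (BettiUniverse.hodge exists_isReal_hodgeModel_holds hB 1).mtRank = 10 ∨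
      (BettiUniverse.hodge exists_isReal_hodgeModel_holds hB 1).mtRank = 11 := by
  obtain ⟨h, -, -, -⟩ := mtRank_hodge_one_mem_of_isSimple_fourfold_of_isTotallyIndefinite hB hBs hB4 hind
  have h7 := mtRank_hodge_one_ne_seven_of_isSimple_fourfold_of_isTotallyIndefinite hB hBs hB4 hind
  tauto

/-! ## §3 Quaternion fourfolds over `ℚ`: definite iff rank `7` -/

omit [HodgeTensorFacts.{0, 0}] in
/-- Over `ℚ` a quaternion algebra is totally definite or totally indefinite (one infinite place). [folklore] -/
private theorem isTotallyDefinite_or_isTotallyIndefinite_rat (D : Type) [Ring D] [Algebra ℚ D] :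
    IsTotallyDefinite ℚ D ∨ Literature.RingTheory.CentralSimple.IsTotallyIndefinite ℚ D := by
  by_cases h : Literature.NumberTheory.Automorphic.IsSplitAtInfinite D Rat.infinitePlace
  · exact Or.inr ⟨fun w => by rwa [Subsingleton.elim w Rat.infinitePlace]⟩
  · exact Or.inl fun w => by rwa [Subsingleton.elim w Rat.infinitePlace]

/-- **DEFINITENESS IS FORCED AT RANK `7`.**  For a simple complex abelian FOURFOLD whose endomorphism algebra is a quaternion
algebra over `ℚ`: **`End⁰B` is totally definite (Albert type III) iff `dim MT(H¹B) = 7`** — `⟹` is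
`CorCM/MumfordTateRankSevenTypeThreeConverse` (Moonen–Zarhin Thm. (0.1) (2): `Hg ∼ SO*(4)`-type, `t = 7`), `⟸` because over `ℚ`
the algebra is otherwise totally indefinite and then `t ∈ {9, 10, 11}` (§2; Moonen–Zarhin Thm. (0.1) (4): `Hg = Sp_D(V, φ)`).
[cite: MoonenZarhin1999LowDim, Thm. (0.1) (2), (4) and §2 (2.3)] [cite: Lange2023AbelianVarietiesComplex, §2.6.2 Thm. 2.6.5 (b), (c)] -/
theorem isTotallyDefinite_iff_mtRank_hodge_one_eq_seven {B : AbelianVariety ℂ} {k : ℕ} (hB : IsSmoothProjective k B.X)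
    (hBs : B.IsSimple) (hB4 : B.dim = 4) [IsQuaternionAlgebra ℚ B.endAlgebra] :
    haveI := BettiUniverse.finite hB 1
    IsTotallyDefinite ℚ B.endAlgebra ↔ (BettiUniverse.hodge exists_isReal_hodgeModel_holds hB 1).mtRank = 7 := by
  constructor
  · intro hdef
    exact (mtRank_hodge_one_eq_seven_of_isSimple_fourfold_of_isTotallyDefinite hB hBs hB4 hdef).1
  · intro h7
    rcases isTotallyDefinite_or_isTotallyIndefinite_rat B.endAlgebra with hdef | hind
    · exact hdef
    · exact absurd h7 (mtRank_hodge_one_ne_seven_of_isSimple_fourfold_of_isTotallyIndefinite hB hBs hB4 hind)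

end Summit.HodgeConjecture.CorCM

end
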